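import Summits.BirchSwinnertonDyer.Rank1Residual.Additive.CensusX42ForallAnomalousThree
import Summits.BirchSwinnertonDyer.Rank1Residual.Additive.RankOneUpperHalfUnitRowsIsogeny
import HarnessLib

/-!
# Rescaling the `p`-adic height datum, VI: the `p = 3` witness against n1011-p16's (S10i)
# ISOGENY-form `∀ Dh` unit-row wrapper (cell `b2b-bsdres`, census cell `bsd-formula-census`, seat
# `b2b-bsdres-census-ctyper1` = conjecture-typer 1, gen 10; prequels `CensusX42ForallAnomalous.lean`,
# `CensusX42ForallAnomalousWitness.lean`, `CensusX42ForallAnomalousThree.lean`; n1011 lead R5-67 (a))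

HONEST FRAMING (cell `b2b-bsdres`, run/shared/lean/b2b/bsd-rank1-residual/, verbatim in every
file): the goal of the cell is to DELETE the COMBINATION-SHAPED residual classes of the
Birch–Swinnerton-Dyer formula for ALL analytic-rank `≤ 1` elliptic curves over `ℚ` — "full BSD
formula for every rank `≤ 1` curve in class `C`" assembled STRICTLY from published theorems — so
that the rank-`≤ 1` remainder becomes exactly the CONSTRUCTION-SHAPED classes, which are TYPED
(missing-input `Prop`s), NOT attempted. This is not "finishing BSD". Census cell
(bsd-formula-census): research instrumentation; census output = EVIDENCE / conjecture items, never a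
Literature fact; labels / RESIDUAL-MAP marks UNCHANGED (O7-ord OPEN; X3♯ / X4♯ CONSTRUCTION-SHAPED);
nothing booked. Theorems only (no definition, no named fact); named facts enter as HYPOTHESES
(`hDel3`, `hWu`, `hGZK`, `hmod`, `hmodD`).

## What (ERRATUM-grade, for n1011-p16 / the n1011 lead / referee 1; third of three witnesses)

n1011-p16's (S10i) `RankOneUpperHalfUnitRowsIsogeny.lean` reads the (S10) unit literal `3 ∤ #Ш_an` on
a `ℚ`-ISOGENOUS curve `E₀` and transports `BSD(E₀,3)` back to `E` by Cassels; its `p = 3` wrapper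
`ClassX3Gord.bsdp_three_rankOne_of_isIsogenous_of_wuthrichHalf_of_delbourgo_of_forall_branchPAdicGrossZagierOdd_of_shaAn_unit`
packages the typed input AT `E₀` as
`hGZ₀ : ∀ Dh, LeadingTermClauses W₀ 3 Dh → SchneiderConjecture Dh ∧ BranchPAdicGrossZagierOddAt W₀ 3 Dh`.
Below, with EXACTLY its binders MINUS `hGZ₀` and MINUS `hCassels` (Cassels' invariance is not needed
to refute; an unused binder would only be lint) PLUS `hanom₀ : ¬ ReductionNonAnomalous W₀ 3` — the
anomalous condition read AT `E₀`, the curve at which (S10i) reads its literal and states `hGZ₀` — the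
hypothesis `hGZ₀` is REFUTED: `E₀ ∈` X3♯(G-ord)@3, `E₀` non-CM, `r_an(E₀) = 1` by p16's own reduction
(`ClassX3Gord.of_isIsogenous`, `hasCM_iff_of_isIsogenous`, `analyticRank_eq_of_isIsogenous'`), then the
prequel's `ClassX3Gord.not_forall_leadingTermClauses_imp_branchPAdicGrossZagierOdd_three_of_delbourgo_of_shaAn_unit_of_anomalous`
AT `E₀` by name. So the (S10i) `∀`-wrapper is TRUE VACUOUSLY whenever the isogenous unit curve `E₀` is
ANOMALOUS at `3` (`3 ∣ #Ẽ₀_{F,w}(𝔽₃)` over the (G)-fields) — NOT coverage there. With this file the three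
`∀ Dh`-packaged `p = 3` unit-row wrappers of ERRATUM 3 (INBOX l.5334 / l.5498; n1011 lead R5-65 (m),
R5-67 (a); r3 `cells/n1011/ROUTE-3.md` l.114–l.120) each have a kernel witness from this seat.
STATEMENT OF RECORD on those rows: p16's POINTWISE isogeny form
`ClassX3Gord.bsdp_rankOne_of_isIsogenous_of_wuthrichHalf_of_branchPAdicGrossZagierOdd_of_shaAn_unit`
(explicit (B)-datum, rider and typed GZ AT `E₀`; `p ≡ 3 (mod 4)` incl. `3`) and this seat's pointwise
window-grade nodes (`CensusX42ValUnitRows.lean`). The (M) isogeny forms (`ClassX3M.…`) are NOT affected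
(`ReductionNonAnomalous W₀ p` holds vacuously on (M): no good place above `p` over the (G)-fields). No
label / mark / count of record changes; nothing booked.

References: D. Delbourgo, J. Number Theory 95 (2002) p. 39 (`ℓ_p(E)`), Thm. (A), (B) (p. 40)
[Delbourgo2002]; C. Wuthrich, Doc. Math. 19 (2014) Thm. 16 [Wuthrich2014]; J. W. S. Cassels, J. reine
angew. Math. 217 (1965) 180–199 [Cassels1965VIII]; R. L. Miller, LMS J. Comput. Math. 14 (2011) Def. 1.1
[Miller2011LMS].
-/

set_option autoImplicit false

noncomputable section

open scoped Classical MatrixGroups ModularForm NumberField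

open CongruenceSubgroup WeierstrassCurve NumberField Literature.NumberTheory.EllipticCurves
  Literature.NumberTheory.EllipticCurves.ModularForms
  Literature.NumberTheory.EllipticCurves.Rank1Residual
  Literature.NumberTheory.EllipticCurves.Rank1Residual.Typed
  Literature.NumberTheory.EllipticCurves.Delbourgo2002
  Literature.NumberTheory.GaloisRepresentations
  Literature.Barriers.BirchSwinnertonDyer
  Summit.BirchSwinnertonDyer.Rank1Residual.X12
  IsDedekindDomain

namespace Summit.BirchSwinnertonDyer.Rank1Residual.Additive

/-! ### §8 The `p = 3` form against n1011-p16's (S10i) isogeny-form `∀ Dh` unit-row wrapper -/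

/-- **p16's (S10i) `ClassX3Gord.bsdp_three_rankOne_of_isIsogenous_of_wuthrichHalf_of_delbourgo_of_forall_branchPAdicGrossZagierOdd_of_shaAn_unit`
is VACUOUS whenever the isogenous unit curve `E₀` is ANOMALOUS at `3`:** with EXACTLY its binders
(`hDel3`, `hWu`, `hGZK`, `hmod`, `hmodD`, `hX : ClassX3Gord W 3`, `hcm`, `hr`, `hiso : E ∼ E₀`, the
census literal `hq₀`/`hv₀` AT `E₀`) minus `hGZ₀` / `hCassels` plus `hanom₀ : ¬ ReductionNonAnomalous W₀ 3`,
its packaging hypothesis `hGZ₀` (AT `E₀`) is REFUTED. Proof: p16's reduction to `E₀` (class, non-CM and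
analytic rank are isogeny invariants on the additive (G)-cell) and the prequel's X3♯(G-ord)@3 witness at
`E₀`. Statement of record there: the pointwise
`ClassX3Gord.bsdp_rankOne_of_isIsogenous_of_wuthrichHalf_of_branchPAdicGrossZagierOdd_of_shaAn_unit`.
[cite: Delbourgo2002, Theorem (A), (B) (p. 40) and p. 39 (ℓ_p(E))] [cite: Wuthrich2014, Thm. 16 (p. 397)] -/
theorem ClassX3Gord.not_forall_leadingTermClauses_imp_branchPAdicGrossZagierOdd_three_of_isIsogenous_of_delbourgo_of_shaAn_unit_of_anomalous
    {W W₀ : WeierstrassCurve ℚ} [W.IsElliptic] [W.IsGloballyMinimal] [W₀.IsElliptic]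
    [W₀.IsGloballyMinimal] [Fact (Nat.Prime 3)]
    (hDel3 : Delbourgo2002.mainTheorem_three)
    (hWu : Wuthrich2014.thm16_halfEigenCharIdeal_dvd_cyclotomicPrime)
    (hGZK : rank_eq_analyticRank_of_analyticRank_le_one) (hmod : hasEntireLFunction_rat)
    (hmodD : nonempty_modularParametrizationData) (hX : ClassX3Gord W 3) (hcm : ¬ W.HasCM)
    (hr : W.analyticRank = 1) (hiso : IsIsogenous W W₀)
    {q₀ : ℚ} (hq₀ : shaAn W₀ = (q₀ : ℂ)) (hv₀ : padicValRat 3 q₀ = 0)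
    (hanom₀ : ¬ ReductionNonAnomalous W₀ 3) :
    ¬ ∀ Dh : PAdicHeightData W₀ 3, LeadingTermClauses W₀ 3 Dh →
        SchneiderConjecture Dh ∧ BranchPAdicGrossZagierOddAt W₀ 3 Dh := by
  -- p16's (S10i) reduction to the isogenous curve `E₀`
  have hX₀ : ClassX3Gord W₀ 3 := hX.of_isIsogenous (by norm_num) hiso
  have hcm₀ : ¬ W₀.HasCM := fun h ↦ hcm ((hasCM_iff_of_isIsogenous hiso).mpr h)
  have hr₀ : W₀.analyticRank = 1 := by rw [← analyticRank_eq_of_isIsogenous' hiso]; exact hr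
  -- the prequel's X3♯(G-ord)@3 witness, AT `E₀`
  exact hX₀.not_forall_leadingTermClauses_imp_branchPAdicGrossZagierOdd_three_of_delbourgo_of_shaAn_unit_of_anomalous
    hDel3 hWu hGZK hmod hmodD hcm₀ hr₀ hq₀ hv₀ hanom₀

end Summit.BirchSwinnertonDyer.Rank1Residual.Additive

end
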